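import Mathlib
import HarnessLib
import Summits.KontsevichZagierPeriods.KontsevichZagierPeriods.Theorems.LinRedNormalFormArrangementNormalFormStubIntegrateOutMoves

/-!
# `stub_integrateOut` (line `janus-bands`), part 2: fibre-free Janus data and one piece

The flat (`k = 0`) Janus format: rational polytopes `poly B Rows`, rational integrands
`ratJ = p / ∏ Lⱼ^{eⱼ}` with affine denominators, the class `JJ0 B` (= the skeleton's `JJ B 0`
verbatim) and `of_mem_JJ0`; then ONE piece of the integration of the last coordinate `y` over
the open band `{(x, y) | x ∈ poly Rows, P(x) < y < S(x)}` between affine neighbours `P < S`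
(rule 3, `newtonLeibniz_pack`):

* pole case `ratJ(x) · (y − ℓ)^{-(n'+2)}`, `ℓ ∉ [P, S]`: rational primitive, output ONE rational
  function over the common denominator `∏ Lⱼ^{eⱼ} (S − ℓ)^{n'+1} (P − ℓ)^{n'+1}`
  (`primG_sub_primG`, `piece_step`) — no splitting (splitting diverges at pinches);
* polynomial case `ratJ(x) · (y − ℓ)^n`: polynomial primitive (`primP_sub_primP`,
  `piece_stepP`).

Registered sub-goal proved here: `integrateOut_of_mem_JJ0`.
[Kontsevich–Zagier 2001, §1.2, rules (1)–(3)]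
-/

noncomputable section

open Set MeasureTheory
open Literature.NumberTheory.Transcendental
open Literature.ModelTheory.ExponentialFields

namespace Summit.KontsevichZagierPeriods.ArrangementNormalForm.JanusBands

namespace IntegrateOut

/-! ### Fibre-free Janus data: rational polytopes and rational integrands -/

/-- A rational polyhedral cell `{x | ∀ ρ ∈ Rows, 0 < ρ(x)}`. [folklore] -/
def poly (B : ℕ) (Rows : Finset ((Fin B → ℚ) × ℚ)) : Set (Fin B → ℝ) :=
  {x | ∀ ρ ∈ Rows, 0 < ev ρ x}

/-- The rational integrand `p / ∏ Lⱼ^{eⱼ}` with affine denominators. [folklore] -/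
def ratJ (B m : ℕ) (L : Fin m → (Fin B → ℚ) × ℚ) (e : Fin m → ℕ) (p : MvPolynomial (Fin B) ℚ)
    (x : Fin B → ℝ) : ℝ :=
  MvPolynomial.aeval x p / ∏ j, ev (L j) x ^ e j

/-- The class `JJ B 0` of the line skeleton (Janus band representations with base dimension `B`
and no fibres), verbatim. [folklore] -/
def JJ0 (B : ℕ) : Set KZ.FormalRep :=
  {w : KZ.FormalRep | ∃ (m m' : ℕ) (s : KZ.IntegralRep (B + 0)) (M : Fin m' → (Fin B → ℚ) × ℚ)
    (L : Fin m → (Fin B → ℚ) × ℚ) (e : Fin m → ℕ) (p : MvPolynomial (Fin B) ℚ)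
    (a : Fin 0 → Option ((Fin B → ℚ) × ℚ)) (lo hi : Fin 0 → Fin 0 ⊕ ((Fin B → ℚ) × ℚ)),
    Bornology.IsBounded s.domain ∧
    s.domain = {z | (∀ j, 0 < ∑ i, ((M j).1 i : ℝ) * z (Fin.castAdd 0 i) + ((M j).2 : ℝ)) ∧
      ∀ i, Sum.elim (fun j => z (Fin.natAdd B j))
          (fun c => ∑ i', (c.1 i' : ℝ) * z (Fin.castAdd 0 i') + (c.2 : ℝ)) (lo i) <
          z (Fin.natAdd B i) ∧
        z (Fin.natAdd B i) < Sum.elim (fun j => z (Fin.natAdd B j))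
          (fun c => ∑ i', (c.1 i' : ℝ) * z (Fin.castAdd 0 i') + (c.2 : ℝ)) (hi i)} ∧
    EqOn s.integrand (fun z => MvPolynomial.aeval (fun i => z (Fin.castAdd 0 i)) p /
        (∏ j, (∑ i, ((L j).1 i : ℝ) * z (Fin.castAdd 0 i) + ((L j).2 : ℝ)) ^ e j) *
      ∏ i, (a i).elim 1 (fun c => 1 / (z (Fin.natAdd B i) -
        (∑ i', (c.1 i' : ℝ) * z (Fin.castAdd 0 i') + (c.2 : ℝ))))) s.domain ∧
    w = KZ.of s}

/-- A representation with a rational polytope as domain and a `ratJ` integrand lies in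
`JJ B 0`. [folklore] -/
theorem of_mem_JJ0 {B m : ℕ} (s : KZ.IntegralRep B) (Rows : Finset ((Fin B → ℚ) × ℚ))
    (L : Fin m → (Fin B → ℚ) × ℚ) (e : Fin m → ℕ) (p : MvPolynomial (Fin B) ℚ)
    (hbd : Bornology.IsBounded s.domain) (hdom : s.domain = poly B Rows)
    (hint : EqOn s.integrand (ratJ B m L e p) s.domain) : KZ.of s ∈ JJ0 B := by
  refine ⟨m, Rows.card, s, fun j => (Rows.equivFin.symm j).1, L, e, p, fun i => i.elim0,
    fun i => i.elim0, fun i => i.elim0, hbd, ?_, fun x hx => ?_, rfl⟩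
  · rw [hdom]
    ext x
    simp only [poly, mem_setOf_eq, ev, IsEmpty.forall_iff, and_true, Fin.castAdd_zero,
      Fin.cast_eq_self]
    exact ⟨fun h j => h _ (Rows.equivFin.symm j).2,
      fun h ρ hρ => by simpa using h (Rows.equivFin ⟨ρ, hρ⟩)⟩
  · rw [hint hx]
    simp [ratJ, ev, Finset.univ_eq_empty]

/-- A rational polytope is `ℚ`-semialgebraic. [folklore] -/
theorem isSemialgebraic_poly (B : ℕ) (Rows : Finset ((Fin B → ℚ) × ℚ)) :
    IsSemialgebraic ℚ (poly B Rows) := by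
  convert IsSemialgebraic.biInter Rows _ fun ρ _ =>
    isSemialgebraic_setOf_eval_pos (k := ℚ) (R := ℝ) (affPoly (id : Fin B → Fin B) ρ) using 1
  ext x
  simp [poly, aeval_affPoly]

/-- The rational integrand `ratJ` is `ℚ`-semialgebraic on every `ℚ`-semialgebraic set
(division with the convention `x / 0 = 0`). [folklore] -/
theorem isSemialgebraicFunOn_ratJ {B m : ℕ} (L : Fin m → (Fin B → ℚ) × ℚ) (e : Fin m → ℕ)
    (p : MvPolynomial (Fin B) ℚ) {σ : Set (Fin B → ℝ)} (hσ : IsSemialgebraic ℚ σ) :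
    IsSemialgebraicFunOn ℚ σ (ratJ B m L e p) :=
  isSemialgebraicFunOn_div (isSemialgebraicFunOn_aeval hσ p)
    (isSemialgebraicFunOn_finset_prod _ hσ fun j _ =>
      isSemialgebraicFunOn_pow (isSemialgebraicFunOn_ev hσ (L j)) _)

/-- The base of a bounded set of the form "band over `τ`" is bounded. [folklore] -/
theorem isBounded_of_snoc_mem {N : ℕ} {τ : Set (Fin N → ℝ)} {D : Set (Fin (N + 1) → ℝ)}
    (hD : Bornology.IsBounded D)
    (hmem : ∀ x ∈ τ, ∃ t : ℝ, (Fin.snoc x t : Fin (N + 1) → ℝ) ∈ D) :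
    Bornology.IsBounded τ := by
  obtain ⟨C, hC⟩ := isBounded_iff_forall_norm_le.mp hD
  refine isBounded_iff_forall_norm_le.mpr ⟨C, fun x hx => ?_⟩
  obtain ⟨t, ht⟩ := hmem x hx
  refine le_trans ?_ (hC _ ht)
  refine (pi_norm_le_iff_of_nonneg (norm_nonneg _)).mpr fun i => ?_
  simpa using norm_le_pi_norm (Fin.snoc x t : Fin (N + 1) → ℝ) (Fin.castSucc i)

/-- The open band over `τ ⊆ ℝᴮ` between two affine functions is `ℚ`-semialgebraic.
[folklore] -/
theorem isSemialgebraic_openBand {B : ℕ} {τ : Set (Fin B → ℝ)} (hτ : IsSemialgebraic ℚ τ)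
    (P S : (Fin B → ℚ) × ℚ) :
    IsSemialgebraic ℚ {w : Fin (B + 1) → ℝ | (Fin.init w : Fin B → ℝ) ∈ τ ∧
      ev P (Fin.init w) < w (Fin.last B) ∧ w (Fin.last B) < ev S (Fin.init w)} := by
  have h1 := isSemialgebraic_setOf_eval_lt (k := ℚ) (R := ℝ)
    (affPoly Fin.castSucc P) (MvPolynomial.X (Fin.last B))
  have h2 := isSemialgebraic_setOf_eval_lt (k := ℚ) (R := ℝ)
    (MvPolynomial.X (Fin.last B)) (affPoly Fin.castSucc S)
  convert hτ.setOf_init_mem.inter (h1.inter h2) using 1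
  ext w
  simp only [mem_setOf_eq, mem_inter_iff, MvPolynomial.aeval_X, aeval_affPoly]
  exact Iff.rfl

/-! ### One piece, pole of order `n' + 2`: Newton–Leibniz with the rational primitive -/

/-- The integrand of a piece in band coordinates (last coordinate `y`):
`ratJ (init w) · (y − ℓ(x))^{-n}`. [folklore] -/
def intG (B m : ℕ) (L : Fin m → (Fin B → ℚ) × ℚ) (e : Fin m → ℕ) (p : MvPolynomial (Fin B) ℚ)
    (ℓ : (Fin B → ℚ) × ℚ) (n : ℕ) (w : Fin (B + 1) → ℝ) : ℝ :=
  ratJ B m L e p (Fin.init w) * (1 / (w (Fin.last B) - ev ℓ (Fin.init w)) ^ n)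

/-- The rational primitive in `y` of `intG … (n' + 2)`:
`(y − ℓ)^{-(n'+1)} / (−(n'+1)) · ratJ`. [folklore] -/
def primG (B m : ℕ) (L : Fin m → (Fin B → ℚ) × ℚ) (e : Fin m → ℕ) (p : MvPolynomial (Fin B) ℚ)
    (ℓ : (Fin B → ℚ) × ℚ) (n' : ℕ) (w : Fin (B + 1) → ℝ) : ℝ :=
  ((w (Fin.last B) - ev ℓ (Fin.init w)) ^ (n' + 1))⁻¹ / (-((n' : ℝ) + 1)) *
    ratJ B m L e p (Fin.init w)

/-- The numerator after integrating out `y` between the affine neighbours `P < S` (pole case):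
`(−1/(n'+1)) · p · ((P − ℓ)^{n'+1} − (S − ℓ)^{n'+1})`. [folklore] -/
def pOut {B : ℕ} (p : MvPolynomial (Fin B) ℚ) (P S ℓ : (Fin B → ℚ) × ℚ) (n' : ℕ) :
    MvPolynomial (Fin B) ℚ :=
  MvPolynomial.C (-1 / ((n' : ℚ) + 1)) * p *
    (affPoly id (P - ℓ) ^ (n' + 1) - affPoly id (S - ℓ) ^ (n' + 1))

/-- The denominator list after integrating out `y`: `L` followed by `S − ℓ` and `P − ℓ`.
[folklore] -/
def LOut {B m : ℕ} (L : Fin m → (Fin B → ℚ) × ℚ) (P S ℓ : (Fin B → ℚ) × ℚ) :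
    Fin (m + 2) → (Fin B → ℚ) × ℚ :=
  Fin.snoc (Fin.snoc L (S - ℓ)) (P - ℓ)

/-- The exponent list after integrating out `y`: `e` followed by `n' + 1` twice. [folklore] -/
def eOut {m : ℕ} (e : Fin m → ℕ) (n' : ℕ) : Fin (m + 2) → ℕ :=
  Fin.snoc (Fin.snoc e (n' + 1)) (n' + 1)

/-- **The value of the `y`-integral in `J`-format** (pole case): for `S − ℓ ≠ 0`, `P − ℓ ≠ 0`
at `x`, `[(S−ℓ)^{-(n'+1)} − (P−ℓ)^{-(n'+1)}]/(−(n'+1)) · ratJ = ratJ'` with the data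
`pOut, LOut, eOut` — one rational function over the common denominator. [folklore] -/
theorem primG_sub_primG {B m : ℕ} (L : Fin m → (Fin B → ℚ) × ℚ) (e : Fin m → ℕ)
    (p : MvPolynomial (Fin B) ℚ) (P S ℓ : (Fin B → ℚ) × ℚ) (n' : ℕ) (x : Fin B → ℝ)
    (hA : ev S x - ev ℓ x ≠ 0) (hB : ev P x - ev ℓ x ≠ 0) :
    primG B m L e p ℓ n' (Fin.snoc x (ev S x)) - primG B m L e p ℓ n' (Fin.snoc x (ev P x)) =
      ratJ B (m + 2) (LOut L P S ℓ) (eOut e n') (pOut p P S ℓ n') x := by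
  simp only [primG, ratJ, Fin.init_snoc, Fin.snoc_last, LOut, eOut, pOut,
    Fin.prod_univ_castSucc, Fin.snoc_castSucc, Fin.snoc_last, map_mul, map_sub, map_pow,
    MvPolynomial.aeval_C, aeval_affPoly, ev_sub]
  set A := ev S x - ev ℓ x
  set B' := ev P x - ev ℓ x
  set D := ∏ j, ev (L j) x ^ e j
  have hn : ((n' : ℝ) + 1) ≠ 0 := by positivity
  by_cases hD : D = 0
  · simp [hD]
  · simp only [eq_ratCast, Rat.cast_div, Rat.cast_neg, Rat.cast_one, Rat.cast_add,
      Rat.cast_natCast, id_eq]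
    field_simp
    ring

/-- **One piece, pole case: integrating `y` out between affine neighbours.** Over the
polytope `τ = poly B Rows` let `P < S` be affine with the pole `ℓ` outside `[P, S]`, and let `r`
live on the open band `{(x, y) | x ∈ τ, P x < y < S x}` with integrand
`ratJ · (y − ℓ)^{-(n'+2)}`. Newton–Leibniz along `y` with the rational primitive (rule 3) yields
a representation on `τ` with ONE rational integrand over the common denominator
`∏ Lⱼ^{eⱼ} (S − ℓ)^{n'+1} (P − ℓ)^{n'+1}`, an element of `JJ B 0`.
[Kontsevich–Zagier 2001, §1.2, rule (3)] [folklore] -/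
theorem piece_step {B m : ℕ} (Rows : Finset ((Fin B → ℚ) × ℚ)) (L : Fin m → (Fin B → ℚ) × ℚ)
    (e : Fin m → ℕ) (p : MvPolynomial (Fin B) ℚ) (P S ℓ : (Fin B → ℚ) × ℚ) (n' : ℕ)
    (hPS : ∀ x ∈ poly B Rows, ev P x < ev S x)
    (hℓ : ∀ x ∈ poly B Rows, ev ℓ x < ev P x ∨ ev S x < ev ℓ x)
    (r : KZ.IntegralRep (B + 1)) (hbd : Bornology.IsBounded r.domain)
    (hrd : r.domain = {w | (Fin.init w : Fin B → ℝ) ∈ poly B Rows ∧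
      ev P (Fin.init w) < w (Fin.last B) ∧ w (Fin.last B) < ev S (Fin.init w)})
    (hri : EqOn r.integrand (intG B m L e p ℓ (n' + 2)) r.domain) :
    ∃ r' : KZ.IntegralRep B, KZ.of r - KZ.of r' ∈ KZ.relations ∧ KZ.of r' ∈ JJ0 B := by
  have hτ : IsSemialgebraic ℚ (poly B Rows) := isSemialgebraic_poly B Rows
  have hBsa := KZlog.isSemialgebraic_band (isSemialgebraicFunOn_ev hτ P)
    (isSemialgebraicFunOn_ev hτ S)
  have hU : IsSemialgebraic ℚ (univ : Set (Fin (B + 1) → ℝ)) := isSemialgebraic_univ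
  have hJu : IsSemialgebraicFunOn ℚ (univ : Set (Fin (B + 1) → ℝ))
      (fun w => ratJ B m L e p (Fin.init w)) :=
    (isSemialgebraicFunOn_ratJ L e p
      (isSemialgebraic_univ : IsSemialgebraic ℚ (univ : Set (Fin B → ℝ)))).comp_init.mono
      (fun _ _ => mem_univ _) hU
  have hYu : IsSemialgebraicFunOn ℚ (univ : Set (Fin (B + 1) → ℝ))
      (fun w => w (Fin.last B) - ev ℓ (Fin.init w)) :=
    (isSemialgebraicFunOn_aeval hU (MvPolynomial.X (Fin.last B) -
      affPoly Fin.castSucc ℓ)).congr fun w _ => by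
        simp only [map_sub, MvPolynomial.aeval_X, aeval_affPoly]; rfl
  have hf : IsSemialgebraicFunOn ℚ (KZlog.band (poly B Rows) (ev P) (ev S))
      (intG B m L e p ℓ (n' + 2)) :=
    (IsSemialgebraicFunOn.mul_holds hJu (isSemialgebraicFunOn_div
      (isSemialgebraicFunOn_ratCast hU 1) (isSemialgebraicFunOn_pow hYu (n' + 2)))).mono
      (subset_univ _) hBsa |>.congr fun w _ => by simp [intG]
  have hF : IsSemialgebraicFunOn ℚ (KZlog.band (poly B Rows) (ev P) (ev S))
      (primG B m L e p ℓ n') :=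
    (IsSemialgebraicFunOn.mul_holds (isSemialgebraicFunOn_div (isSemialgebraicFunOn_div
      (isSemialgebraicFunOn_ratCast hU 1) (isSemialgebraicFunOn_pow hYu (n' + 1)))
      (isSemialgebraicFunOn_ratCast hU (-((n' : ℚ) + 1)))) hJu).mono (subset_univ _) hBsa
      |>.congr fun w _ => by simp [primG, one_div]
  have hne : ∀ x ∈ poly B Rows, ∀ t ∈ Icc (ev P x) (ev S x), t - ev ℓ x ≠ 0 := by
    intro x hx t ht h0
    rw [sub_eq_zero] at h0
    rcases hℓ x hx with h | h
    · exact (h0 ▸ ht.1).not_gt h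
    · exact (h0 ▸ ht.2).not_gt h
  have hcont : ∀ x ∈ poly B Rows, ContinuousOn (fun t => primG B m L e p ℓ n' (Fin.snoc x t))
      (Icc (ev P x) (ev S x)) := by
    intro x hx
    simp only [primG, Fin.init_snoc, Fin.snoc_last]
    exact ContinuousOn.mul (ContinuousOn.div_const (ContinuousOn.inv₀ (by fun_prop)
      fun t ht => pow_ne_zero _ (hne x hx t ht)) _) continuousOn_const
  have hder : ∀ x ∈ poly B Rows, ∀ t ∈ Ioo (ev P x) (ev S x),
      HasDerivAt (fun s => primG B m L e p ℓ n' (Fin.snoc x s))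
        (intG B m L e p ℓ (n' + 2) (Fin.snoc x t)) t := by
    intro x hx t ht
    set c := ev ℓ x with hc
    set K := ratJ B m L e p x with hK
    have htc : t - c ≠ 0 := hne x hx t (Ioo_subset_Icc_self ht)
    have h1 : HasDerivAt (fun s => (s - c) ^ (n' + 1)) (((n' + 1 : ℕ) : ℝ) * (t - c) ^ n') t := by
      have := ((hasDerivAt_id t).sub_const c).pow (n' + 1)
      simp only [id_eq, Nat.add_sub_cancel, mul_one] at this
      exact this
    have h2 := ((h1.inv (pow_ne_zero _ htc)).div_const (-((n' : ℝ) + 1))).mul_const K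
    have hfun : (fun s => primG B m L e p ℓ n' (Fin.snoc x s)) =
        fun s => ((s - c) ^ (n' + 1))⁻¹ / (-((n' : ℝ) + 1)) * K := by
      funext s
      simp [primG, hc, hK]
    rw [hfun]
    refine h2.congr_deriv ?_
    have hn : ((n' : ℝ) + 1) ≠ 0 := by positivity
    simp only [intG, Fin.init_snoc, Fin.snoc_last, Nat.cast_add, Nat.cast_one, ← hc, ← hK]
    field_simp
    ring
  obtain ⟨r', hr'd, hr'i, hrel⟩ := newtonLeibniz_pack hτ (isSemialgebraicFunOn_ev hτ P)
    (isSemialgebraicFunOn_ev hτ S) hPS hf hF hcont hder r hrd hri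
  refine ⟨r', hrel, of_mem_JJ0 r' Rows (LOut L P S ℓ) (eOut e n') (pOut p P S ℓ n') ?_ hr'd
    fun x hx => ?_⟩
  · rw [hr'd]
    refine isBounded_of_snoc_mem hbd fun x hx => ⟨(ev P x + ev S x) / 2, ?_⟩
    rw [hrd]
    have := hPS x hx
    refine ⟨by simpa using hx, ?_, ?_⟩ <;> simp only [Fin.init_snoc, Fin.snoc_last] <;> linarith
  · rw [hr'i]
    rw [hr'd] at hx
    have h1 := hPS x hx
    refine primG_sub_primG L e p P S ℓ n' x ?_ ?_ <;> rcases hℓ x hx with h | h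
    · exact sub_ne_zero.mpr (h.trans h1).ne'
    · exact sub_ne_zero.mpr h.ne
    · exact sub_ne_zero.mpr h.ne'
    · exact sub_ne_zero.mpr (h1.trans h).ne

/-! ### One piece, polynomial factor `(y − ℓ)^n`: Newton–Leibniz with a polynomial primitive -/

/-- The integrand of a piece in band coordinates, polynomial case: `ratJ (init w) · (y − ℓ)^n`.
[folklore] -/
def intP (B m : ℕ) (L : Fin m → (Fin B → ℚ) × ℚ) (e : Fin m → ℕ) (p : MvPolynomial (Fin B) ℚ)
    (ℓ : (Fin B → ℚ) × ℚ) (n : ℕ) (w : Fin (B + 1) → ℝ) : ℝ :=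
  ratJ B m L e p (Fin.init w) * (w (Fin.last B) - ev ℓ (Fin.init w)) ^ n

/-- The polynomial primitive in `y` of `intP … n`: `(y − ℓ)^{n+1}/(n+1) · ratJ`. [folklore] -/
def primP (B m : ℕ) (L : Fin m → (Fin B → ℚ) × ℚ) (e : Fin m → ℕ) (p : MvPolynomial (Fin B) ℚ)
    (ℓ : (Fin B → ℚ) × ℚ) (n : ℕ) (w : Fin (B + 1) → ℝ) : ℝ :=
  (w (Fin.last B) - ev ℓ (Fin.init w)) ^ (n + 1) / ((n : ℝ) + 1) * ratJ B m L e p (Fin.init w)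

/-- The numerator after integrating out `y` between `P < S`, polynomial case:
`p · ((S − ℓ)^{n+1} − (P − ℓ)^{n+1}) / (n+1)`. [folklore] -/
def pOutP {B : ℕ} (p : MvPolynomial (Fin B) ℚ) (P S ℓ : (Fin B → ℚ) × ℚ) (n : ℕ) :
    MvPolynomial (Fin B) ℚ :=
  MvPolynomial.C (1 / ((n : ℚ) + 1)) * p *
    (affPoly id (S - ℓ) ^ (n + 1) - affPoly id (P - ℓ) ^ (n + 1))

/-- The value of the `y`-integral in `J`-format, polynomial case. [folklore] -/
theorem primP_sub_primP {B m : ℕ} (L : Fin m → (Fin B → ℚ) × ℚ) (e : Fin m → ℕ)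
    (p : MvPolynomial (Fin B) ℚ) (P S ℓ : (Fin B → ℚ) × ℚ) (n : ℕ) (x : Fin B → ℝ) :
    primP B m L e p ℓ n (Fin.snoc x (ev S x)) - primP B m L e p ℓ n (Fin.snoc x (ev P x)) =
      ratJ B m L e (pOutP p P S ℓ n) x := by
  simp only [primP, ratJ, Fin.init_snoc, Fin.snoc_last, pOutP, map_mul, map_sub, map_pow,
    MvPolynomial.aeval_C, aeval_affPoly, ev_sub, eq_ratCast, Rat.cast_div, Rat.cast_one,
    Rat.cast_add, Rat.cast_natCast, id_eq]
  ring

/-- **One piece, polynomial case: integrating `y` out between affine neighbours.** Over the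
polytope `τ = poly B Rows` let `P < S` be affine and let `r` live on the open band between them
with integrand `ratJ · (y − ℓ)^n`. Newton–Leibniz along `y` with the polynomial primitive
(rule 3) yields a representation on `τ` with integrand `ratJ'` (new numerator `pOutP`), an
element of `JJ B 0`. [Kontsevich–Zagier 2001, §1.2, rule (3)] [folklore] -/
theorem piece_stepP {B m : ℕ} (Rows : Finset ((Fin B → ℚ) × ℚ)) (L : Fin m → (Fin B → ℚ) × ℚ)
    (e : Fin m → ℕ) (p : MvPolynomial (Fin B) ℚ) (P S ℓ : (Fin B → ℚ) × ℚ) (n : ℕ)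
    (hPS : ∀ x ∈ poly B Rows, ev P x < ev S x)
    (r : KZ.IntegralRep (B + 1)) (hbd : Bornology.IsBounded r.domain)
    (hrd : r.domain = {w | (Fin.init w : Fin B → ℝ) ∈ poly B Rows ∧
      ev P (Fin.init w) < w (Fin.last B) ∧ w (Fin.last B) < ev S (Fin.init w)})
    (hri : EqOn r.integrand (intP B m L e p ℓ n) r.domain) :
    ∃ r' : KZ.IntegralRep B, KZ.of r - KZ.of r' ∈ KZ.relations ∧ KZ.of r' ∈ JJ0 B := by
  have hτ : IsSemialgebraic ℚ (poly B Rows) := isSemialgebraic_poly B Rows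
  have hBsa := KZlog.isSemialgebraic_band (isSemialgebraicFunOn_ev hτ P)
    (isSemialgebraicFunOn_ev hτ S)
  have hU : IsSemialgebraic ℚ (univ : Set (Fin (B + 1) → ℝ)) := isSemialgebraic_univ
  have hJu : IsSemialgebraicFunOn ℚ (univ : Set (Fin (B + 1) → ℝ))
      (fun w => ratJ B m L e p (Fin.init w)) :=
    (isSemialgebraicFunOn_ratJ L e p
      (isSemialgebraic_univ : IsSemialgebraic ℚ (univ : Set (Fin B → ℝ)))).comp_init.mono
      (fun _ _ => mem_univ _) hU
  have hYu : IsSemialgebraicFunOn ℚ (univ : Set (Fin (B + 1) → ℝ))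
      (fun w => w (Fin.last B) - ev ℓ (Fin.init w)) :=
    (isSemialgebraicFunOn_aeval hU (MvPolynomial.X (Fin.last B) -
      affPoly Fin.castSucc ℓ)).congr fun w _ => by
        simp only [map_sub, MvPolynomial.aeval_X, aeval_affPoly]; rfl
  have hf : IsSemialgebraicFunOn ℚ (KZlog.band (poly B Rows) (ev P) (ev S))
      (intP B m L e p ℓ n) :=
    (IsSemialgebraicFunOn.mul_holds hJu (isSemialgebraicFunOn_pow hYu n)).mono
      (subset_univ _) hBsa |>.congr fun w _ => by simp [intP]
  have hF : IsSemialgebraicFunOn ℚ (KZlog.band (poly B Rows) (ev P) (ev S))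
      (primP B m L e p ℓ n) :=
    (IsSemialgebraicFunOn.mul_holds (isSemialgebraicFunOn_div
      (isSemialgebraicFunOn_pow hYu (n + 1)) (isSemialgebraicFunOn_ratCast hU ((n : ℚ) + 1)))
      hJu).mono (subset_univ _) hBsa |>.congr fun w _ => by simp [primP]
  have hcont : ∀ x ∈ poly B Rows, ContinuousOn (fun t => primP B m L e p ℓ n (Fin.snoc x t))
      (Icc (ev P x) (ev S x)) := by
    intro x _
    simp only [primP, Fin.init_snoc, Fin.snoc_last]
    fun_prop
  have hder : ∀ x ∈ poly B Rows, ∀ t ∈ Ioo (ev P x) (ev S x),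
      HasDerivAt (fun s => primP B m L e p ℓ n (Fin.snoc x s))
        (intP B m L e p ℓ n (Fin.snoc x t)) t := by
    intro x _ t _
    set c := ev ℓ x with hc
    set K := ratJ B m L e p x with hK
    have h1 : HasDerivAt (fun s => (s - c) ^ (n + 1)) (((n + 1 : ℕ) : ℝ) * (t - c) ^ n) t := by
      have := ((hasDerivAt_id t).sub_const c).pow (n + 1)
      simp only [id_eq, Nat.add_sub_cancel, mul_one] at this
      exact this
    have h2 := (h1.div_const ((n : ℝ) + 1)).mul_const K
    have hfun : (fun s => primP B m L e p ℓ n (Fin.snoc x s)) =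
        fun s => (s - c) ^ (n + 1) / ((n : ℝ) + 1) * K := by
      funext s
      simp [primP, hc, hK]
    rw [hfun]
    refine h2.congr_deriv ?_
    have hn : ((n : ℝ) + 1) ≠ 0 := by positivity
    simp only [intP, Fin.init_snoc, Fin.snoc_last, Nat.cast_add, Nat.cast_one, ← hc, ← hK]
    field_simp
  obtain ⟨r', hr'd, hr'i, hrel⟩ := newtonLeibniz_pack hτ (isSemialgebraicFunOn_ev hτ P)
    (isSemialgebraicFunOn_ev hτ S) hPS hf hF hcont hder r hrd hri
  refine ⟨r', hrel, of_mem_JJ0 r' Rows L e (pOutP p P S ℓ n) ?_ hr'd fun x hx => ?_⟩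
  · rw [hr'd]
    refine isBounded_of_snoc_mem hbd fun x hx => ⟨(ev P x + ev S x) / 2, ?_⟩
    rw [hrd]
    have := hPS x hx
    refine ⟨by simpa using hx, ?_, ?_⟩ <;> simp only [Fin.init_snoc, Fin.snoc_last] <;> linarith
  · rw [hr'i]
    exact primP_sub_primP L e p P S ℓ n x

end IntegrateOut

open IntegrateOut in
/-- **A rational polytope with a rational integrand is a Janus band representation with no
fibres** (registered sub-goal of `stub_integrateOut`, part 2). -/
theorem integrateOut_of_mem_JJ0 (B m : ℕ) (s : KZ.IntegralRep B) (Rows : Finset ((Fin B → ℚ) × ℚ)) (L : Fin m → (Fin B → ℚ) × ℚ) (e : Fin m → ℕ) (p : MvPolynomial (Fin B) ℚ) (hbd : Bornology.IsBounded s.domain) (hdom : s.domain = IntegrateOut.poly B Rows) (hint : Set.EqOn s.integrand (IntegrateOut.ratJ B m L e p) s.domain) : KZ.of s ∈ IntegrateOut.JJ0 B :=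
  of_mem_JJ0 s Rows L e p hbd hdom hint

end Summit.KontsevichZagierPeriods.ArrangementNormalForm.JanusBands
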